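import Summits.CriticalPhenomena.CardyFormulaZ2.Theorems.CardyFlipRussoVoronoiHubFromSmirnovCellNoVoid
import Summits.CriticalPhenomena.CardyFormulaZ2.Theorems.CardyFlipRussoVoronoiHubFromSmirnovConvexCell
import Literature.Probability.LatticeModels.DelaunayGraph
import Literature.Probability.Percolation.VoronoiCrossing
import Mathlib.Analysis.Convex.PathConnected
import Mathlib.Topology.MetricSpace.HausdorffDistance
import HarnessLib

/-!
# Stub `chain_blackPath` of line `moebius-exact-delaunay-dilation-ward`
# (crux `VoronoiHubFromSmirnov`, stmt-CriticalPhenomena-6433)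

A DELAUNAY CHAIN OF BLACK NUCLEI IS A BLACK PATH.  Let `N₁`, `N₂ ⊆ ℂ` be the black / white nuclei
of a window of a two-coloured configuration (the sites used for Delaunay adjacency,
`ω := N₁ ∪ N₂`), let `B ⊇ N₁` and `W ≠ ∅` be all black / white nuclei, so that the black region is
`Literature.Probability.Percolation.blackRegion B W = {x | infDist x B ≤ infDist x W}`
(Bollobás–Riordan 2006, Ch. 8 §8.1), and let `p₀, …, pₙ ∈ N₁` be a chain of consecutive Delaunay
pairs of `ω` (`Literature.Probability.LatticeModels.IsDelaunayPair`, the empty circumscribed ball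
rule).  Suppose a region `A` contains every disc `closedBall pᵢ (2r)` (`r > 0`), the windowed nuclei
leave no void of radius `r / 2` in `A` (`∀ x ∈ A, ∃ d ∈ ω, dist x d < r / 2`), and the white nuclei
outside the window stay at distance `> r` from `A`.  Then `p₀` and `pₙ` are joined by a path inside
the black region, and consecutive chain points are within distance `2r`.

This is the deterministic conversion "chain arm ⇒ black path" feeding Tassion's annealed one-arm
bound (`VoronoiAnnealedOneArm`) in the re-planned probabilistic stub of the line.

Proof.  With `Vᵢ := voronoiCell ω pᵢ`:
* `Vᵢ ⊆ closedBall pᵢ r` by the landed no-void lemma `voronoiCell_subset_closedBall_of_noVoid`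
  (with `ℓ = r`, `closedBall pᵢ r ⊆ closedBall pᵢ (2r) ⊆ A`);
* every point `x ∈ Vᵢ` is black: `infDist x B ≤ dist x pᵢ` as `pᵢ ∈ N₁ ⊆ B`, while for a white
  nucleus `y`, either `y ∈ N₂ ⊆ ω` and `dist x pᵢ ≤ dist x y` (cell inequality), or `y ∉ N₂` and
  `dist x y > r ≥ dist x pᵢ` (`x ∈ closedBall pᵢ r ⊆ A`); hence `infDist x B ≤ infDist x W`
  (`Metric.le_infDist`, `W ≠ ∅`);
* `Vᵢ` is convex (landed `convex_voronoiCell`), so any two of its points are joined inside it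
  (`JoinedIn.of_segment_subset`);
* consecutive cells meet (`isDelaunayPair_iff_voronoiCell`, the chain points lie in `ω`), say at
  `mᵢ`; the broken line `pᵢ → mᵢ → pᵢ₊₁` lies in `Vᵢ ∪ Vᵢ₊₁ ⊆ blackRegion B W`;
* induction along the chain (`Fin.induction`) with `JoinedIn.trans`;
* the distance bound is `IsDelaunayPair.dist_le_two_mul` with `R = r`.

No new definitions.
-/

noncomputable section

open Metric Set

namespace Summit.CriticalPhenomena.CardyFormulaZ2.Cruxes.VoronoiHubFromSmirnov.MoebiusExactDelaunayDilationWard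

/-- **Small cells of black window nuclei are black.**  If `p ∈ B`, the Voronoi cell of `p` with
respect to `N₁ ∪ N₂` is contained in `closedBall p r`, `closedBall p r ⊆ A`, `W` is nonempty and
every white nucleus `y ∈ W` outside `N₂` is at distance `> r` from every point of `A`, then the
cell is contained in `blackRegion B W`: for `x` in the cell, `infDist x B ≤ dist x p ≤ dist x y` for
every `y ∈ W` (cell inequality if `y ∈ N₂`, `dist x p ≤ r < dist x y` otherwise). [folklore] -/
theorem cbp_voronoiCell_subset_blackRegion {N₁ N₂ B W A : Set ℂ} {p : ℂ} {r : ℝ}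
    (hpB : p ∈ B) (hW : W.Nonempty)
    (hcell : Literature.Probability.LatticeModels.voronoiCell (N₁ ∪ N₂) p ⊆ closedBall p r)
    (hA : closedBall p r ⊆ A) (hfar : ∀ x ∈ A, ∀ y ∈ W, y ∉ N₂ → r < dist x y) :
    Literature.Probability.LatticeModels.voronoiCell (N₁ ∪ N₂) p ⊆
      Literature.Probability.Percolation.blackRegion B W := by
  intro x hx
  rw [Literature.Probability.Percolation.mem_blackRegion]
  have hxr : dist x p ≤ r := mem_closedBall.1 (hcell hx)
  have hxA : x ∈ A := hA (hcell hx)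
  calc infDist x B ≤ dist x p := infDist_le_dist_of_mem hpB
    _ ≤ infDist x W := by
      rw [le_infDist hW]
      intro y hy
      by_cases hyN : y ∈ N₂
      · exact hx y (Or.inr hyN)
      · exact hxr.trans (hfar x hxA y hy hyN).le

/-- **Two points of one Voronoi cell are joined inside any superset of the cell**: the cell is
convex (`convex_voronoiCell`), so the segment between the two points stays in it
(`JoinedIn.of_segment_subset`). [folklore] -/
theorem cbp_joinedIn_of_mem_voronoiCell {ω S : Set ℂ} {p x y : ℂ}
    (hS : Literature.Probability.LatticeModels.voronoiCell ω p ⊆ S)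
    (hx : x ∈ Literature.Probability.LatticeModels.voronoiCell ω p)
    (hy : y ∈ Literature.Probability.LatticeModels.voronoiCell ω p) : JoinedIn S x y :=
  (JoinedIn.of_segment_subset ((convex_voronoiCell ω p).segment_subset hx hy)).mono hS

/-- **A Delaunay chain of black nuclei is a black path.**  With `ω := N₁ ∪ N₂` the windowed
nuclei, `B ⊇ N₁`, `W ≠ ∅` all black / white nuclei, `p₀, …, pₙ ∈ N₁` consecutive Delaunay pairs of
`ω`, `A ⊇ closedBall pᵢ (2r)` for all `i`, no void of radius `r / 2` of `ω` in `A`, and white nuclei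
outside `N₂` at distance `> r` from `A`: the chain endpoints `p₀`, `pₙ` are joined inside
`blackRegion B W`, and `dist pᵢ pᵢ₊₁ ≤ 2r`.  Each cell `voronoiCell ω pᵢ` lies in `closedBall pᵢ r`
(`voronoiCell_subset_closedBall_of_noVoid`), is black (`cbp_voronoiCell_subset_blackRegion`) and
convex; consecutive cells meet (`isDelaunayPair_iff_voronoiCell`), so the broken line through a
common point joins `pᵢ` to `pᵢ₊₁` in the black region, and `Fin.induction` concatenates; the
distance bound is `IsDelaunayPair.dist_le_two_mul`. [folklore] -/
theorem chain_blackPath : ∀ (N₁ N₂ B W A : Set ℂ) (r : ℝ) (n : ℕ) (p : Fin (n + 1) → ℂ), 0 < r → N₁ ⊆ B → W.Nonempty → (∀ i, p i ∈ N₁) → (∀ i : Fin n, Literature.Probability.LatticeModels.IsDelaunayPair (N₁ ∪ N₂) (p i.castSucc) (p i.succ)) → (∀ i, Metric.closedBall (p i) (2 * r) ⊆ A) → (∀ x ∈ A, ∃ d ∈ N₁ ∪ N₂, dist x d < r / 2) → (∀ x ∈ A, ∀ y ∈ W, y ∉ N₂ → r < dist x y) → JoinedIn (Literature.Probability.Percolation.blackRegion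 B W) (p 0) (p (Fin.last n)) ∧ ∀ i : Fin n, dist (p i.castSucc) (p i.succ) ≤ 2 * r := by
  intro N₁ N₂ B W A r n p hr hNB hW hp hD hA hvoid hfar
  -- the cells of the chain points are small ...
  have hrA : ∀ i, closedBall (p i) r ⊆ A := fun i =>
    (closedBall_subset_closedBall (by linarith)).trans (hA i)
  have hcell : ∀ i, Literature.Probability.LatticeModels.voronoiCell (N₁ ∪ N₂) (p i) ⊆
      closedBall (p i) r := fun i =>
    voronoiCell_subset_closedBall_of_noVoid (N₁ ∪ N₂) A (p i) r hr (hrA i) hvoid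
  -- ... hence black
  have hblack : ∀ i, Literature.Probability.LatticeModels.voronoiCell (N₁ ∪ N₂) (p i) ⊆
      Literature.Probability.Percolation.blackRegion B W := fun i =>
    cbp_voronoiCell_subset_blackRegion (hNB (hp i)) hW (hcell i) (hrA i) hfar
  have hpω : ∀ i, p i ∈ N₁ ∪ N₂ := fun i => Or.inl (hp i)
  -- one step of the chain: through a common point of the two cells
  have hstep : ∀ i : Fin n, JoinedIn (Literature.Probability.Percolation.blackRegion B W)
      (p i.castSucc) (p i.succ) := by
    intro i
    obtain ⟨m, hm₁, hm₂⟩ :=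
      (Literature.Probability.LatticeModels.isDelaunayPair_iff_voronoiCell (hpω i.castSucc)
        (hpω i.succ)).1 (hD i)
    exact (cbp_joinedIn_of_mem_voronoiCell (hblack i.castSucc)
        (Literature.Probability.LatticeModels.self_mem_voronoiCell _ _) hm₁).trans
      (cbp_joinedIn_of_mem_voronoiCell (hblack i.succ) hm₂
        (Literature.Probability.LatticeModels.self_mem_voronoiCell _ _))
  refine ⟨?_, fun i => ?_⟩
  · -- concatenate along the chain
    have hall : ∀ k : Fin (n + 1), JoinedIn (Literature.Probability.Percolation.blackRegion B W)
        (p 0) (p k) := by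
      intro k
      induction k using Fin.induction with
      | zero =>
        exact JoinedIn.refl
          (hblack 0 (Literature.Probability.LatticeModels.self_mem_voronoiCell _ _))
      | succ i ih => exact ih.trans (hstep i)
    exact hall (Fin.last n)
  · -- consecutive chain points are within `2r`
    rw [dist_comm]
    exact (hD i).dist_le_two_mul (hcell i.castSucc)

end Summit.CriticalPhenomena.CardyFormulaZ2.Cruxes.VoronoiHubFromSmirnov.MoebiusExactDelaunayDilationWard

end
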